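import Summits.CriticalPhenomena.SAWScalingLimit.Theses.SAWReversalUpgrade
import Literature.Probability.RandomPlanarGeometry.LocalMartingaleProofs
import Literature.Probability.RandomPlanarGeometry.SAWScalingLimitFamily

/-!
# Load-bearing hypotheses of crux `SAWReversalUpgrade.ForwardDriving` (stmt-CriticalPhenomena-18003)

Refuter (cdisprove, cycle 1), hypothesis mutation of the crux
`Summit.CriticalPhenomena.SAWScalingLimit.Theses.SAWReversalUpgrade.ForwardDriving` ("the Loewner
driving function, read through a chordal uniformizer `φ`, of the standardly attached critical SAW
converges in law on every `[0,T]` to `√(8/3) B`").  Three negative lemmas, each the crux with ONE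
ingredient removed, each FALSE; the crux itself is untouched:

* `forwardDriving_false_without_reachable` — the `reachable` field of `SAW.IsEndpointApprox` dropped
  (both mesh-point limits kept).  Witness: unit disc, `a δ = (⌈δ⁻¹⌉₊+1, 0)`, `b δ = -(a δ)`: mesh points
  `→ ±1` from outside the disc, no SAW joins them, `SAW.law = 0`, and `∫ 1 d0 = 0 ↛ 1`.
* `forwardDriving_false_without_range` — the two `Set.range (att δ γ) = …` clauses of the standard
  attachment dropped (injective / source / target / interior kept).  Witness: unit disc, the CONSTANT
  attachment `t ↦ 1 - 2t`; a Dirac driving law is not Wiener (`not_tendstoLaw_const_sleDriving`: the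
  law of `brownian 1` is `gaussianReal 0 1`, which has no atom).
* `not_forwardDrivingRaw` — the attachment removed altogether (driving function of the raw polyline
  class `γ.curve`).  FALSE BY JUNK: `γ.curve` starts at the interior point `δ·a δ ∈ D`, a
  Loewner-described class starts at `φ.boundaryExtension (W 0) ∈ ∂D`
  (`JordanDomain.exists_hasBoundaryValue_holds`), so `drivingFunction φ γ.curve = 0` for every walk
  and the law of the zero path is not that of `√(8/3)B|[0,1]`.  (Why the attachment is not cosmetic.)
-/

open scoped NNReal Topology BoundedContinuousFunction
open Filter Set MeasureTheory ProbabilityTheory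
open Literature.Probability.RandomPlanarGeometry Literature.Probability Literature.Probability.LatticeModels

namespace Summit.CriticalPhenomena.SAWScalingLimit.Theorems.ForwardDriving.Negative

/-! ### §0  Common tool: a deterministic path is not `√κ B` in law -/

/-- The law of `√κ B₁` under the pre-Wiener measure has no atom, so no family of laws under which
the observed path is ONE FIXED point `x₀ ∈ C(Icc 0 1, ℝ)` converges in law (`TendstoLaw`, bounded
continuous test functions) to `ω ↦ (√κ B(ω))|[0,1]`, for `κ > 0`.  Test function
`w ↦ min 1 |w 1 - x₀ 1|`; then `brownian 1 = x₀ 1/√κ` a.s., contradicting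
`HasLaw (brownian 1) (gaussianReal 0 1)` and `gaussianReal 0 1 ≪ volume`. [folklore] -/
theorem not_tendstoLaw_const_sleDriving {Ωδ : ℝ → Type*} [∀ δ, MeasurableSpace (Ωδ δ)]
    (P : ∀ δ, Measure (Ωδ δ)) (x₀ : C(Set.Icc (0:ℝ≥0) 1, ℝ)) {κ : ℝ≥0} (hκ : 0 < κ) :
    ¬ TendstoLaw (fun δ (_ : Ωδ δ) => x₀) P
      (fun ω : ℝ≥0 → ℝ => ((⟨sleDriving κ ω, continuous_sleDriving κ ω⟩ : C(ℝ≥0, ℝ)).restrict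
        (Set.Icc (0:ℝ≥0) 1))) Process.preWienerMeasure := by
  intro h
  haveI := isProbabilityMeasure_preWienerMeasure'
  set t₁ : Set.Icc (0:ℝ≥0) 1 := ⟨1, by simp⟩ with ht₁
  -- test function
  let g : C(Set.Icc (0:ℝ≥0) 1, ℝ) → ℝ := fun w => min 1 |w t₁ - x₀ t₁|
  have hgc : Continuous g := by
    have : Continuous fun w : C(Set.Icc (0:ℝ≥0) 1, ℝ) => w t₁ := continuous_eval_const t₁
    exact continuous_const.min ((this.sub continuous_const).abs)
  have hg0 : ∀ w, 0 ≤ g w := fun w => le_min zero_le_one (abs_nonneg _)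
  have hg1 : ∀ w, g w ≤ 1 := fun w => min_le_left _ _
  let f : C(Set.Icc (0:ℝ≥0) 1, ℝ) →ᵇ ℝ :=
    BoundedContinuousFunction.mkOfBound ⟨g, hgc⟩ 1 (by
      intro w w'
      simp only [ContinuousMap.coe_mk, Real.dist_eq]
      have := hg0 w; have := hg1 w; have := hg0 w'; have := hg1 w'
      rw [abs_le]; constructor <;> linarith)
  have hf : ∀ w, f w = g w := fun w => rfl
  have hfx : f x₀ = 0 := by
    rw [hf]; simp [g]
  have h1 := h f
  simp only [hfx, integral_zero] at h1
  have h2 := tendsto_const_nhds_iff.mp h1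
  -- the limit integral vanishes
  have hint : ∫ ω, f (((⟨sleDriving κ ω, continuous_sleDriving κ ω⟩ : C(ℝ≥0, ℝ)).restrict
        (Set.Icc (0:ℝ≥0) 1))) ∂Process.preWienerMeasure = 0 := h2.symm
  have hexp : ∀ ω, f (((⟨sleDriving κ ω, continuous_sleDriving κ ω⟩ : C(ℝ≥0, ℝ)).restrict
        (Set.Icc (0:ℝ≥0) 1))) = min 1 |Real.sqrt κ * Process.brownian 1 ω - x₀ t₁| := by
    intro ω
    rw [hf]
    simp [g, ContinuousMap.restrict_apply, sleDriving_apply, ht₁]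
  simp_rw [hexp] at hint
  have hmeas : Measurable fun ω => min 1 |Real.sqrt κ * Process.brownian 1 ω - x₀ t₁| :=
    measurable_const.min (((Process.measurable_brownian 1).const_mul _).sub_const _).abs
  have hintg : Integrable (fun ω => min 1 |Real.sqrt κ * Process.brownian 1 ω - x₀ t₁|)
      Process.preWienerMeasure :=
    Integrable.of_bound hmeas.aestronglyMeasurable 1 (ae_of_all _ fun ω => by
      rw [Real.norm_eq_abs, abs_of_nonneg (le_min zero_le_one (abs_nonneg _))]
      exact min_le_left _ _)
  have hae := (integral_eq_zero_iff_of_nonneg (fun ω => le_min zero_le_one (abs_nonneg _)) hintg).mp hint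
  -- hence `brownian 1 = c` a.e.
  set c : ℝ := x₀ t₁ / Real.sqrt κ with hc
  have hsq : 0 < Real.sqrt κ := Real.sqrt_pos.2 (by exact_mod_cast hκ)
  have hae' : ∀ᵐ ω ∂Process.preWienerMeasure, Process.brownian 1 ω = c := by
    filter_upwards [hae] with ω hω
    simp only [Pi.zero_apply] at hω
    have h3 : |Real.sqrt κ * Process.brownian 1 ω - x₀ t₁| = 0 := by
      rcases min_eq_iff.mp hω with h | h
      · exact absurd h.1 one_ne_zero
      · exact h.1
    rw [abs_eq_zero, sub_eq_zero] at h3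
    rw [hc, eq_div_iff hsq.ne', mul_comm]; exact h3
  -- contradiction with the Gaussian law of `brownian 1`
  have hlaw := Process.hasLaw_brownian_sub exists_isBrownianReal_measurable_continuous_holds 1 0
  rw [Process.brownian_zero, sub_zero] at hlaw
  have hlaw' : HasLaw (Process.brownian 1) (gaussianReal 0 1) Process.preWienerMeasure := by
    convert hlaw using 2
    simp [NNReal.val_eq_coe]
  have hP : Process.preWienerMeasure {ω | Process.brownian 1 ω = c} = 1 := by
    rw [← measure_univ (μ := Process.preWienerMeasure)]
    refine measure_congr ?_
    refine Filter.eventuallyEq_set.mpr ?_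
    filter_upwards [hae'] with ω hω
    simp [hω]
  have hG : gaussianReal 0 1 {x | x = c} = 0 := by
    have : {x : ℝ | x = c} = {c} := by ext; simp
    rw [this]
    exact gaussianReal_absolutelyContinuous 0 one_ne_zero (Real.volume_singleton)
  have key := hlaw'.measure_eq (p := fun x => x = c) (by
    have : {x : ℝ | x = c} = {c} := by ext; simp
    rw [this]; exact measurableSet_singleton c)
  rw [hP, hG] at key
  exact one_ne_zero key

/-! ### §A  Load-bearing: the `reachable` field of `IsEndpointApprox` -/

/-- **`reachable` is load-bearing** (the crux with `IsEndpointApprox` replaced by its two limit fields is false).  Witness: the unit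
disc with lattice endpoints `a δ = (⌈δ⁻¹⌉₊ + 1, 0)`, `b δ = (-(⌈δ⁻¹⌉₊ + 1), 0)`: their mesh points
`±δ(⌈δ⁻¹⌉₊+1) → ±1 = D.pt 0, D.pt 1` but lie OUTSIDE the open disc for every `δ > 0`, so `a δ` is
no mesh vertex, no SAW of `Ω_δ` starts there (`DomainSAW` is empty, `a δ ≠ b δ`), `SAW.law = 0`,
the attachment hypothesis is vacuous, and `∫ 1 dlaw = 0` does not tend to `∫ 1 dℙ_W = 1`.
(Junk-flavoured negative: reachability is exactly what makes the SAW law a probability law.) [folklore] -/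
theorem forwardDriving_false_without_reachable :
    ¬ (∀ (D : Literature.Probability.RandomPlanarGeometry.DobrushinDomain) (a b : ℝ → Literature.Probability.LatticeModels.Site 2), Filter.Tendsto (fun δ => Literature.Probability.LatticeModels.meshPoint δ (a δ)) (nhdsWithin (0:ℝ) (Set.Ioi 0)) (nhds (D.pt 0)) → Filter.Tendsto (fun δ => Literature.Probability.LatticeModels.meshPoint δ (b δ)) (nhdsWithin (0:ℝ) (Set.Ioi 0)) (nhds (D.pt 1)) → ∀ (φ : Literature.Probability.RandomPlanarGeometry.ConformalEquiv UpperHalfPlane.upperHalfPlaneSet D.carrier), D.IsChordalUniformizing φ → ∀ (att : ((δ : ℝ) → Literature.Probability.RandomPlanarGeometry.SAW.DomainSAW (D).carrier δ (a δ) (b δ) → Literature.Probability.RandomPlanarGeometry.Curve ℂ)), (∀ᶠ δ in (nhdsWithin (0:ℝ) (Set.Ioi 0)), ∀ γ : Literature.Probability.RandomPlanarGeometry.SAW.DomainSAW (D).carrier δ (a δ) (b δ), (let a₁ := (D).pt 0; let b₁ := (D).pt 1; let P₁ : C(unitInterval, ℂ) := (γ.walk.toCurve (Literature.Probability.LatticeModels.meshPoint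 δ)); let R₁ := fun u : ℝ => P₁ (Set.projIcc (0:ℝ) 1 zero_le_one u); let φ₁ := (φ).boundaryExtension; let ψ₁ := Function.invFunOn φ₁ {z : ℂ | 0 ≤ z.im}; let e₁ : ℝ := min δ (1/2); let A₁ := fun z : ℂ => (‖z‖ : ℂ) * Complex.exp (Complex.I * ((e₁ : ℂ) + (1 - 2 * (e₁ : ℂ) / (Real.pi : ℂ)) * (Complex.arg z : ℂ))); let Z₁ := fun u : ℝ => @ite ℂ (R₁ u = b₁) (Classical.propDecidable _) b₁ (φ₁ (A₁ (ψ₁ (R₁ u)))); let i₁ := sSup ({(0:ℝ)} ∪ {u | u ∈ Set.Icc (0:ℝ) 1 ∧ R₁ u = a₁}); let j₁ := sInf ({(1:ℝ)} ∪ {u | u ∈ Set.Icc (0:ℝ) 1 ∧ R₁ u = b₁}); let M₁ := Z₁ '' Set.Icc i₁ j₁; let p₁ := A₁ (ψ₁ (R₁ i₁)); let q₁ := A₁ (ψ₁ (R₁ j₁)); let s₁ := sInf {s | s ∈ Set.Ioc (0:ℝ) 1 ∧ φ₁ ((s : ℂ) * p₁) ∈ M₁}; let r₁ := sSup ({(1:ℝ)}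 ∪ {r | 1 ≤ r ∧ R₁ j₁ ≠ b₁ ∧ φ₁ ((r : ℂ) * q₁) ∈ M₁}); let u₁ := sInf {u | u ∈ Set.Icc i₁ j₁ ∧ Z₁ u = φ₁ ((s₁ : ℂ) * p₁)}; let v₁ := sSup ({u | u ∈ Set.Icc i₁ j₁ ∧ R₁ j₁ = b₁ ∧ u = j₁} ∪ {u | u ∈ Set.Icc i₁ j₁ ∧ R₁ j₁ ≠ b₁ ∧ Z₁ u = φ₁ ((r₁ : ℂ) * q₁)}); let S₁ := ((({a₁, b₁} ∪ ((fun s : ℝ => φ₁ ((s : ℂ) * p₁)) '' Set.Ioc 0 s₁)) ∪ (Z₁ '' Set.Icc u₁ v₁)) ∪ ((fun r : ℝ => φ₁ ((r : ℂ) * q₁)) '' {r | r₁ ≤ r ∧ R₁ j₁ ≠ b₁})); Function.Injective (att δ γ) ∧ (att δ γ).source = a₁ ∧ (att δ γ).target = b₁ ∧ (∀ t : unitInterval, (att δ γ) t = a₁ ∨ (att δ γ) t = b₁ ∨ (att δ γ) t ∈ (D).carrier) ∧ (u₁ < v₁ → Set.range (att δ γ) = S₁) ∧ (¬ u₁ <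 v₁ → Set.range (att δ γ) = {a₁, b₁} ∪ ((fun y : ℝ => φ₁ (Complex.I * (y : ℂ))) '' Set.Ioi 0)))) → ∀ T : NNReal, Literature.Probability.RandomPlanarGeometry.TendstoLaw (fun δ (γ : Literature.Probability.RandomPlanarGeometry.SAW.DomainSAW D.carrier δ (a δ) (b δ)) => ((⟨Literature.Probability.RandomPlanarGeometry.drivingFunction (φ) (Literature.Probability.RandomPlanarGeometry.CurveClass.mk (att δ γ)), Literature.Probability.RandomPlanarGeometry.continuous_drivingFunction (φ) (Literature.Probability.RandomPlanarGeometry.CurveClass.mk (att δ γ))⟩ : C(NNReal, ℝ)).restrict (Set.Icc (0:NNReal) T))) (fun δ => Literature.Probability.RandomPlanarGeometry.SAW.law (D).carrier δ (a δ) (b δ)) (fun ω : NNReal → ℝ => ((⟨Literature.Probability.RandomPlanarGeometry.sleDriving ((8:NNReal)/3) ω, Literature.Probability.RandomPlanarGeometry.continuous_sleDriving ((8:NNReal)/3) ω⟩ : C(NNReal, ℝ)).restrict (Set.Icc (0:NNReal) T))) Literature.Probability.Process.preWienerMeasure) := by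
  intro H
  classical
  haveI := isProbabilityMeasure_preWienerMeasure'
  set D := DobrushinDomain.unitDisc with hD
  have hpt0 : D.pt 0 = 1 := by
    rw [hD]; simp [MarkedDomain.pt, DobrushinDomain.unitDisc, JordanDomain.unitDisc, circleMap]
  have hpt1 : D.pt 1 = -1 := by
    have h : D.pt 1 = circleMap 0 1 (2 * Real.pi * (1 / 2)) := by rw [hD]; rfl
    rw [h, circleMap]
    have : ((2 * Real.pi * (1 / 2) : ℝ) : ℂ) * Complex.I = Real.pi * Complex.I := by push_cast; ring
    rw [this, Complex.exp_pi_mul_I]; simp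
  let N : ℝ → ℕ := fun δ => ⌈δ⁻¹⌉₊ + 1
  let a : ℝ → Site 2 := fun δ => ![(N δ : ℤ), 0]
  let b : ℝ → Site 2 := fun δ => ![-(N δ : ℤ), 0]
  have hmeshA : ∀ δ, meshPoint δ (a δ) = ((δ * N δ : ℝ) : ℂ) := by
    intro δ; apply Complex.ext <;> simp [a, meshPoint_re, meshPoint_im]
  have hmeshB : ∀ δ, meshPoint δ (b δ) = ((-(δ * N δ) : ℝ) : ℂ) := by
    intro δ; apply Complex.ext <;> simp [b, meshPoint_re, meshPoint_im]
  have hlow : ∀ δ, 0 < δ → 1 + δ ≤ δ * N δ := by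
    intro δ hδ
    have h1 : δ⁻¹ ≤ (⌈δ⁻¹⌉₊ : ℝ) := Nat.le_ceil _
    have : δ * (N δ : ℝ) = δ * (⌈δ⁻¹⌉₊ : ℝ) + δ := by simp [N]; ring
    rw [this]
    have h2 : δ * δ⁻¹ ≤ δ * (⌈δ⁻¹⌉₊ : ℝ) := mul_le_mul_of_nonneg_left h1 hδ.le
    rw [mul_inv_cancel₀ hδ.ne'] at h2
    linarith
  have hupp : ∀ δ, 0 < δ → δ * N δ ≤ 1 + 2 * δ := by
    intro δ hδ
    have h1 : (⌈δ⁻¹⌉₊ : ℝ) < δ⁻¹ + 1 := Nat.ceil_lt_add_one (inv_nonneg.2 hδ.le)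
    have : δ * (N δ : ℝ) = δ * (⌈δ⁻¹⌉₊ : ℝ) + δ := by simp [N]; ring
    rw [this]
    have h2 : δ * (⌈δ⁻¹⌉₊ : ℝ) ≤ δ * (δ⁻¹ + 1) := mul_le_mul_of_nonneg_left h1.le hδ.le
    rw [mul_add, mul_inv_cancel₀ hδ.ne', mul_one] at h2
    linarith
  have hr : Tendsto (fun δ : ℝ => δ * N δ) (𝓝[>] 0) (𝓝 1) := by
    have hl : Tendsto (fun δ : ℝ => 1 + δ) (𝓝[>] 0) (𝓝 1) := by
      have : Tendsto (fun δ : ℝ => 1 + δ) (𝓝 0) (𝓝 (1 + 0)) :=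
        tendsto_const_nhds.add tendsto_id
      rw [add_zero] at this
      exact this.mono_left nhdsWithin_le_nhds
    have hu : Tendsto (fun δ : ℝ => 1 + 2 * δ) (𝓝[>] 0) (𝓝 1) := by
      have : Tendsto (fun δ : ℝ => 1 + 2 * δ) (𝓝 0) (𝓝 (1 + 2 * 0)) :=
        tendsto_const_nhds.add (tendsto_id.const_mul 2)
      rw [mul_zero, add_zero] at this
      exact this.mono_left nhdsWithin_le_nhds
    refine tendsto_of_tendsto_of_tendsto_of_le_of_le' hl hu ?_ ?_
    · filter_upwards [self_mem_nhdsWithin] with δ hδ using hlow δ hδ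
    · filter_upwards [self_mem_nhdsWithin] with δ hδ using hupp δ hδ
  have hta : Tendsto (fun δ => meshPoint δ (a δ)) (𝓝[>] 0) (𝓝 (D.pt 0)) := by
    rw [hpt0]
    have h := (Complex.continuous_ofReal.tendsto 1).comp hr
    rw [Complex.ofReal_one] at h
    refine h.congr fun δ => ?_
    simp only [Function.comp_apply]
    exact (hmeshA δ).symm
  have htb : Tendsto (fun δ => meshPoint δ (b δ)) (𝓝[>] 0) (𝓝 (D.pt 1)) := by
    rw [hpt1]
    have h := (Complex.continuous_ofReal.tendsto (-1)).comp hr.neg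
    refine (h.congr fun δ => ?_).trans (by simp)
    simp only [Function.comp_apply]
    exact (hmeshB δ).symm
  obtain ⟨φ, hφ⟩ := MarkedDomain.exists_isChordalUniformizing_holds D
  -- `a δ` is not a mesh vertex of the disc
  have hnotin : ∀ δ, 0 < δ → a δ ∉ meshVertices D.carrier δ := by
    intro δ hδ h
    rw [mem_meshVertices_iff, hmeshA] at h
    change ((δ * N δ : ℝ) : ℂ) ∈ Metric.ball (0:ℂ) 1 at h
    rw [Metric.mem_ball, dist_zero_right, Complex.norm_real, Real.norm_eq_abs] at h
    have := hlow δ hδ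
    rw [abs_of_nonneg (by linarith)] at h
    linarith
  have hne : ∀ δ, a δ ≠ b δ := by
    intro δ h
    have h0 := congrFun h 0
    simp only [N, a, b, Matrix.cons_val_zero] at h0
    push_cast at h0
    omega
  have hempty : ∀ δ, 0 < δ → IsEmpty (SAW.DomainSAW D.carrier δ (a δ) (b δ)) := by
    intro δ hδ
    refine ⟨fun γ => ?_⟩
    have hlen : 0 < γ.walk.length :=
      Nat.pos_of_ne_zero fun h0 => hne δ (SimpleGraph.Walk.eq_of_length_eq_zero h0)
    have hadj := γ.walk.adj_getVert_succ hlen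
    rw [SimpleGraph.Walk.getVert_zero] at hadj
    exact hnotin δ hδ (meshDomain_subset_meshVertices _ _ (discreteDomainGraph_adj_iff.1 hadj).2.1)
  have hlaw : ∀ δ, 0 < δ → SAW.law D.carrier δ (a δ) (b δ) = 0 := by
    intro δ hδ
    haveI := hempty δ hδ
    exact Measure.eq_zero_of_isEmpty _
  have H' := H D a b hta htb φ hφ (fun _ _ => ⟨ContinuousMap.const unitInterval (0:ℂ)⟩) (by
    filter_upwards [self_mem_nhdsWithin] with δ hδ γ
    exact (hempty δ hδ).elim γ) 1 (BoundedContinuousFunction.const _ 1)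
  have h1 := H'.congr' (f₂ := fun _ : ℝ => (0:ℝ)) (by
    filter_upwards [self_mem_nhdsWithin] with δ hδ
    rw [hlaw δ hδ, integral_zero_measure])
  have h2 := tendsto_const_nhds_iff.mp h1
  simp at h2

/-! ### §B  Load-bearing: the range prescription of the standard attachment -/

/-- **The range clause is load-bearing** (the crux with the attachment hypothesis cut to its first four conjuncts is false): without it the
attachment may ignore the walk.  Witness: unit disc `(𝔻; 1, -1)`, any endpoint approximation
(`SAW.exists_isEndpointApprox`), any chordal uniformizer, and the CONSTANT attachment
`att δ γ := (t ↦ 1 - 2t)` (the diameter: injective, from `1` to `-1`, interior in `𝔻`).  Its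
driving path through `φ` is one fixed element of `C(Icc 0 1)`, whose Dirac law is not the law of
`√(8/3) B|[0,1]` (`not_tendstoLaw_const_sleDriving`). [folklore] -/
theorem forwardDriving_false_without_range :
    ¬ (∀ (D : Literature.Probability.RandomPlanarGeometry.DobrushinDomain) (a b : ℝ → Literature.Probability.LatticeModels.Site 2), Literature.Probability.RandomPlanarGeometry.SAW.IsEndpointApprox D a b → ∀ (φ : Literature.Probability.RandomPlanarGeometry.ConformalEquiv UpperHalfPlane.upperHalfPlaneSet D.carrier), D.IsChordalUniformizing φ → ∀ (att : ((δ : ℝ) → Literature.Probability.RandomPlanarGeometry.SAW.DomainSAW (D).carrier δ (a δ) (b δ) → Literature.Probability.RandomPlanarGeometry.Curve ℂ)), (∀ᶠ δ in (nhdsWithin (0:ℝ) (Set.Ioi 0)), ∀ γ : Literature.Probability.RandomPlanarGeometry.SAW.DomainSAW (D).carrier δ (a δ) (b δ), Function.Injective (att δ γ) ∧ (att δ γ).source = (D).pt 0 ∧ (att δ γ).target = (D).pt 1 ∧ (∀ t : unitInterval, (att δ γ) t = (D).pt 0 ∨ (att δ γ) t = (D).pt 1 ∨ (att δ γ) t ∈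 (D).carrier)) → ∀ T : NNReal, Literature.Probability.RandomPlanarGeometry.TendstoLaw (fun δ (γ : Literature.Probability.RandomPlanarGeometry.SAW.DomainSAW D.carrier δ (a δ) (b δ)) => ((⟨Literature.Probability.RandomPlanarGeometry.drivingFunction (φ) (Literature.Probability.RandomPlanarGeometry.CurveClass.mk (att δ γ)), Literature.Probability.RandomPlanarGeometry.continuous_drivingFunction (φ) (Literature.Probability.RandomPlanarGeometry.CurveClass.mk (att δ γ))⟩ : C(NNReal, ℝ)).restrict (Set.Icc (0:NNReal) T))) (fun δ => Literature.Probability.RandomPlanarGeometry.SAW.law (D).carrier δ (a δ) (b δ)) (fun ω : NNReal → ℝ => ((⟨Literature.Probability.RandomPlanarGeometry.sleDriving ((8:NNReal)/3) ω, Literature.Probability.RandomPlanarGeometry.continuous_sleDriving ((8:NNReal)/3) ω⟩ : C(NNReal, ℝ)).restrict (Set.Icc (0:NNReal) T))) Literature.Probability.Process.preWienerMeasure) := by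
  intro H
  set D := DobrushinDomain.unitDisc with hD
  have hpt0 : D.pt 0 = 1 := by
    rw [hD]; simp [MarkedDomain.pt, DobrushinDomain.unitDisc, JordanDomain.unitDisc, circleMap]
  have hpt1 : D.pt 1 = -1 := by
    have h : D.pt 1 = circleMap 0 1 (2 * Real.pi * (1 / 2)) := by rw [hD]; rfl
    rw [h, circleMap]
    have : ((2 * Real.pi * (1 / 2) : ℝ) : ℂ) * Complex.I = Real.pi * Complex.I := by push_cast; ring
    rw [this, Complex.exp_pi_mul_I]; simp
  obtain ⟨a, b, hab⟩ := SAW.exists_isEndpointApprox D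
  obtain ⟨φ, hφ⟩ := MarkedDomain.exists_isChordalUniformizing_holds D
  let c₀ : Curve ℂ := ⟨⟨fun t : unitInterval => ((1 - 2 * (t : ℝ) : ℝ) : ℂ), by fun_prop⟩⟩
  have hc₀ : ∀ t : unitInterval, c₀ t = ((1 - 2 * (t : ℝ) : ℝ) : ℂ) := fun t => rfl
  have hinj : Function.Injective c₀ := by
    intro s t h
    rw [hc₀, hc₀] at h
    have := Complex.ofReal_injective h
    exact Subtype.ext (by linarith)
  have hsrc : c₀.source = D.pt 0 := by
    rw [hpt0]; show c₀ 0 = 1; rw [hc₀]; simp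
  have htgt : c₀.target = D.pt 1 := by
    rw [hpt1]; show c₀ 1 = -1; rw [hc₀]; norm_num
  have hint : ∀ t : unitInterval, c₀ t = D.pt 0 ∨ c₀ t = D.pt 1 ∨ c₀ t ∈ D.carrier := by
    intro t
    rcases eq_or_ne (t : ℝ) 0 with h0 | h0
    · left; rw [hpt0, hc₀, h0]; simp
    rcases eq_or_ne (t : ℝ) 1 with h1 | h1
    · right; left; rw [hpt1, hc₀, h1]; norm_num
    right; right
    change c₀ t ∈ Metric.ball (0:ℂ) 1
    rw [hc₀, Metric.mem_ball, dist_zero_right, Complex.norm_real, Real.norm_eq_abs, abs_lt]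
    have ht0 : (0:ℝ) < t := lt_of_le_of_ne t.2.1 (Ne.symm h0)
    have ht1 : (t:ℝ) < 1 := lt_of_le_of_ne t.2.2 h1
    constructor <;> linarith
  have H' := H D a b hab φ hφ (fun _ _ => c₀)
    (Filter.Eventually.of_forall fun δ γ => ⟨hinj, hsrc, htgt, hint⟩) 1
  exact not_tendstoLaw_const_sleDriving (fun δ => SAW.law D.carrier δ (a δ) (b δ))
    (((⟨drivingFunction φ (CurveClass.mk c₀), continuous_drivingFunction φ _⟩ : C(ℝ≥0, ℝ)).restrict
      (Set.Icc (0:ℝ≥0) 1))) (κ := (8:ℝ≥0)/3) (by norm_num) H'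

/-! ### §C  A refuted natural simplification: the raw polyline class has junk driving function -/

/-- **The naive form is false, by junk** (the crux read on `γ.curve` with no attachment): for small `δ` the polyline class
`γ.curve` of every SAW starts at the INTERIOR point `meshPoint δ (a δ) ∈ D` (its first vertex lies in
`Ω_δ ⊆ Ω` as soon as `a δ ≠ b δ`), whereas every Loewner-described class through `φ` starts at
`φ.boundaryExtension (W 0)`, a boundary value at the REAL point `W 0`, which lies on `∂D`
(`exists_hasBoundaryValue_holds`) hence not in the open set `D`.  So `γ.curve` is never
`IsLoewnerDescribable φ`, `drivingFunction φ γ.curve = 0` (`drivingFunction_of_not`), and the law of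
the zero path is not that of `√(8/3)B|[0,1]`.  Unit disc, any endpoint approximation, any
uniformizer.  Moral: the attachment `att` (a curve starting AT `D.pt 0`) is not cosmetic. [folklore] -/
theorem not_forwardDrivingRaw :
    ¬ (∀ (D : Literature.Probability.RandomPlanarGeometry.DobrushinDomain) (a b : ℝ → Literature.Probability.LatticeModels.Site 2), Literature.Probability.RandomPlanarGeometry.SAW.IsEndpointApprox D a b → ∀ (φ : Literature.Probability.RandomPlanarGeometry.ConformalEquiv UpperHalfPlane.upperHalfPlaneSet D.carrier), D.IsChordalUniformizing φ → ∀ T : NNReal, Literature.Probability.RandomPlanarGeometry.TendstoLaw (fun δ (γ : Literature.Probability.RandomPlanarGeometry.SAW.DomainSAW D.carrier δ (a δ) (b δ)) => ((⟨Literature.Probability.RandomPlanarGeometry.drivingFunction (φ) ((γ.curve)), Literature.Probability.RandomPlanarGeometry.continuous_drivingFunction (φ) ((γ.curve))⟩ : C(NNReal, ℝ)).restrict (Set.Icc (0:NNReal) T))) (fun δ => Literature.Probability.RandomPlanarGeometry.SAW.law (D).carrier δ (a δ) (b δ)) (fun ω : NNReal → ℝ => ((⟨Literature.Probability.RandomPlanarGeometry.sleDriving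 ((8:NNReal)/3) ω, Literature.Probability.RandomPlanarGeometry.continuous_sleDriving ((8:NNReal)/3) ω⟩ : C(NNReal, ℝ)).restrict (Set.Icc (0:NNReal) T))) Literature.Probability.Process.preWienerMeasure) := by
  intro H
  set D := DobrushinDomain.unitDisc with hD
  have hpt0 : D.pt 0 = 1 := by
    rw [hD]; simp [MarkedDomain.pt, DobrushinDomain.unitDisc, JordanDomain.unitDisc, circleMap]
  have hpt1 : D.pt 1 = -1 := by
    have h : D.pt 1 = circleMap 0 1 (2 * Real.pi * (1 / 2)) := by rw [hD]; rfl
    rw [h, circleMap]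
    have : ((2 * Real.pi * (1 / 2) : ℝ) : ℂ) * Complex.I = Real.pi * Complex.I := by push_cast; ring
    rw [this, Complex.exp_pi_mul_I]; simp
  obtain ⟨a, b, hab⟩ := SAW.exists_isEndpointApprox D
  obtain ⟨φ, hφ⟩ := MarkedDomain.exists_isChordalUniformizing_holds D
  -- eventually the two lattice endpoints differ
  have hne : ∀ᶠ δ in 𝓝[>] (0:ℝ), a δ ≠ b δ := by
    have ha := hab.tendsto_fst
    have hb := hab.tendsto_snd
    rw [hpt0] at ha
    rw [hpt1] at hb
    filter_upwards [ha (Metric.ball_mem_nhds (1:ℂ) one_pos),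
      hb (Metric.ball_mem_nhds (-1:ℂ) one_pos)] with δ hδa hδb heq
    simp only [Set.mem_preimage, Metric.mem_ball] at hδa hδb
    rw [heq] at hδa
    have h2 : dist (1:ℂ) (-1) = 2 := by
      rw [Complex.dist_eq]; norm_num
    have h3 := dist_triangle (1:ℂ) (meshPoint δ (b δ)) (-1)
    rw [dist_comm (1:ℂ) (meshPoint δ (b δ))] at h3
    linarith
  -- eventually no SAW class is Loewner-describable through `φ`
  have hnd : ∀ᶠ δ in 𝓝[>] (0:ℝ), ∀ γ : SAW.DomainSAW D.carrier δ (a δ) (b δ),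
      ¬ IsLoewnerDescribable φ γ.curve := by
    filter_upwards [hne] with δ hδne γ hdesc
    obtain ⟨W, -, γ', hgen, c', hc', hci⟩ := hdesc
    have hlen : 0 < γ.walk.length :=
      Nat.pos_of_ne_zero fun h0 => hδne (SimpleGraph.Walk.eq_of_length_eq_zero h0)
    have hadj := γ.walk.adj_getVert_succ hlen
    rw [SimpleGraph.Walk.getVert_zero] at hadj
    have hmem : meshPoint δ (a δ) ∈ D.carrier :=
      meshDomain_subset_meshVertices _ _ (discreteDomainGraph_adj_iff.1 hadj).2.1
    have hs1 : (γ.curve).source = meshPoint δ (a δ) := by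
      change (CurveClass.mk _).source = _
      rw [CurveClass.source_mk]
      exact SimpleGraph.Walk.toCurve_apply_zero _ _
    have hs2 : (γ.curve).source = φ.boundaryExtension (W 0) := by
      rw [hc', CurveClass.source_mk]
      change c' 0 = _
      rw [hci.1 0 (by norm_num), rayParam_zero, hgen.2.1]
    obtain ⟨p, hp, hpv⟩ := JordanDomain.exists_hasBoundaryValue_holds D.toJordanDomain φ (W 0)
    have hcl : ((W 0 : ℝ) : ℂ) ∈ closure UpperHalfPlane.upperHalfPlaneSet :=
      mem_closure_upperHalfPlaneSet_iff.2 (by simp)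
    have hext : φ.boundaryExtension (W 0) = p := φ.boundaryExtension_eq_of_hasBoundaryValue hcl hpv
    rw [D.isOpen.frontier_eq] at hp
    exact hp.2 (hext ▸ hs2 ▸ hs1 ▸ hmem)
  -- hence the observed path is the zero path, eventually for every walk
  have H' := H D a b hab φ hφ 1
  refine not_tendstoLaw_const_sleDriving (fun δ => SAW.law D.carrier δ (a δ) (b δ))
    ((0 : C(ℝ≥0, ℝ)).restrict (Set.Icc (0:ℝ≥0) 1)) (κ := (8:ℝ≥0)/3) (by norm_num) ?_
  intro f
  refine (H' f).congr' ?_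
  filter_upwards [hnd] with δ hδ
  refine integral_congr_ae (ae_of_all _ fun γ => ?_)
  simp only
  congr 1
  ext t
  simp [ContinuousMap.restrict_apply, drivingFunction_of_not (hδ γ)]

end Summit.CriticalPhenomena.SAWScalingLimit.Theorems.ForwardDriving.Negative
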